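import Literature.Computability.AlgebraicComplexity.BurgisserBooleanPartsA3Assembly

/-!
# LangWeilTransfer, support item `TameResolution` (stmt-ValiantsHypothesis-6378) — size calculus
# for substitutions (weights and total degrees under `aeval`, flattening of nested polynomials)

Route `LangWeilTransfer` of `ValiantsHypothesis` (conditional route; honest framing: bookkeeping,
nothing here bears on VP ≠ VNP). Tools of the QUANTITATIVE pass (roadmap note of val-lit-p6 g9):
every specialisation step (`α ↦ a`, `Λ ↦ c`, the integer linear change `Γ`) is an `aeval` by
polynomials of bounded weight and total degree `≤ 1`, and the nested rings `ℤ[T][X']` are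
flattened to `ℤ[X' ⊔ T]` before weights are taken.

* `weight_aeval_le_mul_pow` — `wt(F(g)) ≤ wt(F) · M^{deg F}` if every `wt(g_v) ≤ M`, `1 ≤ M`
  (Bürgisser 2000 TCS §2: submultiplicativity of the weight);
* `totalDegree_aeval_le_mul` — `deg F(g) ≤ e · deg F` if every `deg g_v ≤ e`;
* `weight_sumAlgEquiv_symm_le` — the weight of the flattening of `p ∈ ℤ[T][X']` is at most the
  sum of the weights of its `X'`-coefficients.
-/

noncomputable section

open MvPolynomial
open Literature.Computability.AlgebraicComplexity

-- the summit and the problem share the name `ValiantsHypothesis` (D-0017 single-conjunct layout)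
set_option linter.dupNamespace false

namespace Summit.ValiantsHypothesis.ValiantsHypothesis.Theorems.LangWeilTransfer

variable {σ τ : Type*}

/-- **Weight under substitution.** If every `g_v` has weight `≤ M` (`1 ≤ M`), then
`wt(aeval g F) ≤ wt(F) · M ^ (totalDegree F)`. -/
theorem weight_aeval_le_mul_pow (g : σ → MvPolynomial τ ℤ) {M : ℕ} (hM : 1 ≤ M)
    (hg : ∀ v, weight (g v) ≤ M) (F : MvPolynomial σ ℤ) :
    weight (aeval g F) ≤ weight F * M ^ F.totalDegree := by
  classical
  conv_lhs => rw [F.as_sum]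
  rw [map_sum]
  refine (weight_finset_sum_le _ _).trans ?_
  have hwt : weight F = F.support.sum fun d => (F.coeff d).natAbs := rfl
  rw [hwt, Finset.sum_mul]
  refine Finset.sum_le_sum fun d hd => ?_
  rw [aeval_monomial, MvPolynomial.algebraMap_eq]
  refine (weight_mul_le _ _).trans ?_
  rw [weight_C]
  refine Nat.mul_le_mul_left _ ?_
  simp only [Finsupp.prod]
  refine (weight_finset_prod_le _ _).trans ?_
  calc ∏ i ∈ d.support, weight (g i ^ d i)
      ≤ ∏ i ∈ d.support, M ^ d i := Finset.prod_le_prod (fun _ _ => Nat.zero_le _) fun i _ =>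
          (weight_pow_le _ _).trans (Nat.pow_le_pow_left (hg i) _)
    _ = M ^ (∑ i ∈ d.support, d i) := Finset.prod_pow_eq_pow_sum _ _ _
    _ ≤ M ^ F.totalDegree := Nat.pow_le_pow_right hM (le_totalDegree hd)

/-- **Total degree under substitution.** If every `g_v` has total degree `≤ e`, then
`deg (aeval g F) ≤ e · deg F`. -/
theorem totalDegree_aeval_le_mul {R : Type*} [CommRing R] (g : σ → MvPolynomial τ R) {e : ℕ}
    (hg : ∀ v, (g v).totalDegree ≤ e) (F : MvPolynomial σ R) :
    (aeval g F).totalDegree ≤ e * F.totalDegree := by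
  classical
  conv_lhs => rw [F.as_sum]
  rw [map_sum]
  refine totalDegree_finsetSum_le fun d hd => ?_
  rw [aeval_monomial, MvPolynomial.algebraMap_eq]
  refine (totalDegree_mul _ _).trans ?_
  rw [totalDegree_C, zero_add]
  simp only [Finsupp.prod]
  refine (totalDegree_finsetProd _ _).trans ?_
  calc ∑ i ∈ d.support, (g i ^ d i).totalDegree
      ≤ ∑ i ∈ d.support, d i * e := Finset.sum_le_sum fun i _ =>
          (totalDegree_pow _ _).trans (Nat.mul_le_mul_left _ (hg i))
    _ = (∑ i ∈ d.support, d i) * e := (Finset.sum_mul _ _ _).symm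
    _ ≤ F.totalDegree * e := Nat.mul_le_mul_right _ (le_totalDegree hd)
    _ = e * F.totalDegree := mul_comm _ _

/-- **Flattening does not increase the weight count.** For `p ∈ ℤ[T][X']` (`X'` indexed by
`S₁`, `T` by `S₂`), the weight of `(sumAlgEquiv ℤ S₁ S₂).symm p ∈ ℤ[X' ⊔ T]` is at most
`Σ_{β ∈ supp p} wt(coeff_β p)`. -/
theorem weight_sumAlgEquiv_symm_le {S₁ S₂ : Type*} (p : MvPolynomial S₁ (MvPolynomial S₂ ℤ)) :
    weight ((sumAlgEquiv ℤ S₁ S₂).symm p) ≤ p.support.sum fun β => weight (p.coeff β) := by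
  classical
  conv_lhs => rw [p.as_sum]
  rw [map_sum]
  refine (weight_finset_sum_le _ _).trans (Finset.sum_le_sum fun β _ => ?_)
  -- `flat (monomial β c) = rename inr c * Π_i X(inl i)^{β i}`
  have hmon : (sumAlgEquiv ℤ S₁ S₂).symm (monomial β (p.coeff β)) =
      rename Sum.inr (p.coeff β) * β.prod fun i k => X (Sum.inl i) ^ k := by
    rw [monomial_eq, map_mul]
    congr 1
    · -- constants: `C c ↦ rename inr c`
      have : ((sumAlgEquiv ℤ S₁ S₂).symm.toAlgHom.comp
          (IsScalarTower.toAlgHom ℤ (MvPolynomial S₂ ℤ) (MvPolynomial S₁ (MvPolynomial S₂ ℤ)))) =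
          rename Sum.inr := by
        refine MvPolynomial.algHom_ext fun j => ?_
        simp only [AlgHom.comp_apply, IsScalarTower.toAlgHom_apply, MvPolynomial.algebraMap_eq, rename_X]
        exact sumAlgEquiv_symm_C_X (R := ℤ) (S₁ := S₁) (c := j)
      have h := congrArg (fun φ => φ (p.coeff β)) this
      simp only [AlgHom.comp_apply, IsScalarTower.toAlgHom_apply, MvPolynomial.algebraMap_eq] at h
      exact h
    · simp only [Finsupp.prod, map_prod, map_pow, sumAlgEquiv_symm_X]
  rw [hmon]
  refine (weight_mul_le _ _).trans ?_
  rw [weight_rename_of_injective Sum.inr_injective]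
  refine (Nat.mul_le_mul_left _ ?_).trans (le_of_eq (Nat.mul_one _))
  simp only [Finsupp.prod]
  refine (weight_finset_prod_le _ _).trans (Finset.prod_le_one (fun _ _ => Nat.zero_le _) fun i _ => ?_)
  refine (weight_pow_le _ _).trans ?_
  have hX : weight (X (Sum.inl i : S₁ ⊕ S₂) : MvPolynomial (S₁ ⊕ S₂) ℤ) = 1 := by
    rw [show (X (Sum.inl i) : MvPolynomial (S₁ ⊕ S₂) ℤ) = monomial (Finsupp.single (Sum.inl i) 1) 1 from rfl,
      weight_monomial]; rfl
  rw [hX, one_pow]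

end Summit.ValiantsHypothesis.ValiantsHypothesis.Theorems.LangWeilTransfer
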